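import Summits.BirchSwinnertonDyer.BirchSwinnertonDyer.Theorems.ByReductionTypeAtTwoAdditivePotGoodPrintKrizLi92b1Base
import Summits.BirchSwinnertonDyer.BirchSwinnertonDyer.Theorems.ByReductionTypeAtTwoSupersingularUnitAnchorsC
import Literature.NumberTheory.EllipticCurves.OrdinaryPrimesProofs
import Literature.NumberTheory.EllipticCurves.LeadingTermTamagawaProofs
import Mathlib.Tactic.NormNum.LegendreSymbol
import HarnessLib

/-!
# Route `GenusKolyvaginAtTwo`, crux U₂ `MinimalTwinBSDTwo` (stmt-BirchSwinnertonDyer-22985), LINE 23 «twin_swap»: KERNEL data of the Kriz–Li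
# RANK-**ZERO** ANCHOR `67a1 = [0,1,1,-12,-21]` (Cremona Table 1 «67 67A1»: `N = 67`, `r = 0`, `E(ℚ) ≅ 0`, `Δ = -67`, `I1` at `67`, GOOD at `2`;
# Kriz–Li §6 TABLE 2 row `67a1 | −7 | 1 | ✓`) over `K = ℚ(√−7)` — ellipticity, global minimality, `E[2]` irreducible (the `2`-division cubic
# `X³ + (4)X² + (-192)X + (-1328)` has no root mod `17`), good reduction at `2` with `c₂ = 1`, non-CM, `N = 67` EXACTLY; the partner
# `67a1^{(−7)} = [0,-7,1,-588,7117]` (`I₀*` at `7`, `I1` at `67`: `N = 7²·67 = 3283 < 5000`); the packet witness `ℓ = 29` (`#Ẽ(𝔽_29) = 35`, `a_29 = -5` odd)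

Seat `bsd-line-gk2-p2` g35 (PROVER 2/3, cell `bsd-f1-sign2`; LINE 23 holder), `--supports stmt-BirchSwinnertonDyer-22985` (helper; closes nothing).
KERNEL THEOREMS ONLY (0 `def`, 0 `sorry`, no named fact); standard axioms.  Companion of `…KrizLiAnchor11a1Base.lean` (this seat, g35: the first
RANK-ZERO Table-2 anchor) and of `…KrizLiAnchor37a1Base/43a1Base.lean` (g34: rank-one Table-1 anchors with `d_K²·N < 5000`): `67a1` is a rank-ZERO row of
Kriz–Li's Table 2 that is GOOD at `2` with `c₂ = 1` and `49·N = 3283 < 5000`, so BOTH numerical `BSD(2)` inputs of Kriz–Li Thm 5.1 (2) (the base and its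
companion `67a1^{(−7)}`) lie in Creutz–Miller's range and `BSD₂` on the whole packet `{67a1^{(d)}, 67a1^{(−7d)} : d ∈ 𝒩, χ_d(−67) = 1}` follows from PRINT
ALONE (road file `…KrizLiAnchor67a1.lean`); the RANK-ONE half (`67a1^{(−7d)}` and the partner) consists of U₂-class curves.  Tate certificate at `7` for
the partner: the b2b engine `DeepCert` (exit `6` = `I₀*`, translation `t = 24`).  Closes nothing; nothing booked; **BSD is NOT proved by any of this;
U₂ is NOT proved.**

References: [KrizLi2019] Thm 5.1 (2), Def 4.1, §6 Example 6.5 and Table 2 (row 67a1, arXiv:1606.03172v3 Congruence.tex l. 1046); [CremonaAlgorithms1997]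
Table 1 (67A1; 3283); [SilvermanAEC2009] III.2.3, VII.1, VII.5, X.5, App. C §11; [Silverman1994] IV.9.4, IV.11.1; [Kraus1989] Prop. 1–2.
-/

set_option autoImplicit false
-- the Theorems namespace of this sub repeats the summit name by design (D-0017 nested layout)
set_option linter.dupNamespace false

noncomputable section

open scoped Classical NumberField

open WeierstrassCurve IsDedekindDomain Rat.HeightOneSpectrum Literature.NumberTheory.EllipticCurves
  Literature.NumberTheory.EllipticCurves.ModularForms
  Literature.NumberTheory.EllipticCurves.Rank1Residual
  Literature.NumberTheory.DiophantineGeometry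
  Summit.BirchSwinnertonDyer
  Summit.BirchSwinnertonDyer.Rank1Residual
  Summit.BirchSwinnertonDyer.Rank1Residual.X11b
  Summit.BirchSwinnertonDyer.Rank1Residual.X5.O1
  Summit.BirchSwinnertonDyer.Rank1Residual.P2
  Summit.BirchSwinnertonDyer.BirchSwinnertonDyer.Rank1Residual.IntModel
  Summit.BirchSwinnertonDyer.BirchSwinnertonDyer.Theorems
  Summit.BirchSwinnertonDyer.BirchSwinnertonDyer.Theorems.AddPotGoodPrint
  Summit.BirchSwinnertonDyer.BirchSwinnertonDyer.Rank2Observatory.Tate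

namespace Summit.BirchSwinnertonDyer.BirchSwinnertonDyer.Theorems.GenusExact.TwinSwap.KrizLiAnchor67a1

/-! ## §1 The anchor `67a1 = [0,1,1,-12,-21]`: `Δ = -67`, `c₄ = 592`, GOOD at `2`, `I1` at `67` -/
section Base67A1

/-- `67a1 = [0,1,1,-12,-21]` is an elliptic curve (`Δ = -67 ≠ 0`). [cite: CremonaAlgorithms1997, Table 1 (67A1)] -/
theorem isElliptic_67A1 : (⟨0, 1, 1, -12, -21⟩ : WeierstrassCurve ℚ).IsElliptic := ⟨by
  rw [isUnit_iff_ne_zero]; norm_num [WeierstrassCurve.Δ, WeierstrassCurve.b₂, WeierstrassCurve.b₄, WeierstrassCurve.b₆, WeierstrassCurve.b₈]⟩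

/-- `67a1` is GLOBALLY MINIMAL (`|Δ| = 67^1`). [cite: SilvermanAEC2009, VII.1 Remark 1.1] [cite: Kraus1989, Prop. 1 and Prop. 2] -/
theorem isGloballyMinimal_67A1 : (⟨0, 1, 1, -12, -21⟩ : WeierstrassCurve ℚ).IsGloballyMinimal :=
  isGloballyMinimal_of_krausCriterion_support (0) (1) (1) (-12) (-21) [(67, 0, 1)]
    (by intro t ht; simp only [List.mem_cons, List.not_mem_nil, or_false] at ht
        rcases ht with rfl; norm_num)
    (by decide +kernel) (by decide +kernel)

-- `Δ(67a1) = −67`, `c₄(67a1) = 592` on the integer model: the tree's `SSUnitAnchor.ua67a1_Δ` / `ua67a1_c₄` (wall cell, unit-zone anchors).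

/-- The integer model of `67a1` is Cremona's. [cite: SilvermanAEC2009, VIII.8] -/
theorem intModel_67A1 :
    haveI := isElliptic_67A1; haveI := isGloballyMinimal_67A1
    integralModelInt (⟨0, 1, 1, -12, -21⟩ : WeierstrassCurve ℚ) = (⟨0, 1, 1, -12, -21⟩ : WeierstrassCurve ℤ) :=
  haveI := isElliptic_67A1; haveI := isGloballyMinimal_67A1
  integralModelInt_eq_of_map_eq _ (by ext <;> simp [WeierstrassCurve.map])

/-- The integer model base-changed to `ℚ` is the rational model. [folklore] -/
theorem baseChange_int_67A1 : (⟨0, 1, 1, -12, -21⟩ : WeierstrassCurve ℤ).baseChange ℚ = (⟨0, 1, 1, -12, -21⟩ : WeierstrassCurve ℚ) := by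
  ext <;> simp [WeierstrassCurve.baseChange, WeierstrassCurve.map]

/-- `b₂, b₄, b₆` of `67a1`. [cite: SilvermanAEC2009, III.1] -/
theorem b_67A1 : (⟨0, 1, 1, -12, -21⟩ : WeierstrassCurve ℚ).b₂ = ((4 : ℤ) : ℚ) ∧ (⟨0, 1, 1, -12, -21⟩ : WeierstrassCurve ℚ).b₄ = ((-24 : ℤ) : ℚ) ∧
    (⟨0, 1, 1, -12, -21⟩ : WeierstrassCurve ℚ).b₆ = ((-83 : ℤ) : ℚ) := by
  simp only [WeierstrassCurve.b₂, WeierstrassCurve.b₄, WeierstrassCurve.b₆]; norm_num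

/-- **`E[2]` irreducible for `67a1`** (`E(ℚ)[2] = 0`; Cremona: `E(ℚ) ≅ 0`): the monic `2`-division cubic `X³ + (4)X² + (-192)X + (-1328)` has no root modulo `17`.
[cite: SilvermanAEC2009, III.2.3 (b)] [cite: KrizLi2019, Thm. 5.1 (hypothesis E(ℚ)[2] = 0) and §6 Example 6.5] -/
theorem irr_two_67A1 :
    haveI := isElliptic_67A1
    Irr (⟨0, 1, 1, -12, -21⟩ : WeierstrassCurve ℚ) 2 :=
  haveI := isElliptic_67A1
  irr_two_of_forall_cubic_ne _ b_67A1.1 b_67A1.2.1 b_67A1.2.2 (ℓ := 17) (by decide)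

/-- **`E(ℚ)[2] = 0` for `67a1`** in Kriz–Li's shape. [cite: KrizLi2019, Thm. 5.1 hypothesis "E(ℚ)[2] = 0"] -/
theorem twoTorsion_67A1 :
    haveI := isElliptic_67A1
    ∀ Q : (⟨0, 1, 1, -12, -21⟩ : WeierstrassCurve ℚ).toAffine.Point, 2 • Q = 0 → Q = 0 :=
  haveI := isElliptic_67A1
  (X5.O1.irr_two_iff_forall_two_nsmul _).mp irr_two_67A1

/-- **`67a1` has GOOD reduction at `2`** (`2 ∤ Δ_min = -67`). [cite: SilvermanAEC2009, VII.5 Prop. 5.1 (a)] [cite: KrizLi2019, §6 Table 2 (row 67a1: c₂ = 1)] -/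
theorem hasGoodReductionAtPrime_two_67A1 :
    haveI := isGloballyMinimal_67A1; haveI : Fact (Nat.Prime 2) := ⟨Nat.prime_two⟩
    (⟨0, 1, 1, -12, -21⟩ : WeierstrassCurve ℚ).HasGoodReductionAtPrime 2 := by
  haveI := isElliptic_67A1; haveI := isGloballyMinimal_67A1
  haveI : Fact (Nat.Prime 2) := ⟨Nat.prime_two⟩
  refine hasGoodReductionAtPrime_of_not_dvd _ 2 ?_
  rw [minimalDiscriminantInt_eq intModel_67A1, SSUnitAnchor.ua67a1_Δ]; decide

/-- **`c₂(67a1) = 1`** (good reduction: Tate's Step 1). [cite: SilvermanAEC2009, VII.2 remark after Prop. 2.1] [cite: KrizLi2019, §6 Table 2 (row 67a1: c₂ = 1)] -/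
theorem localTamagawaNumber_two_67A1 :
    haveI : Fact (Nat.Prime 2) := ⟨Nat.prime_two⟩
    ((⟨0, 1, 1, -12, -21⟩ : WeierstrassCurve ℚ).baseChange ℚ_[2]).localTamagawaNumber ℤ_[2] = 1 :=
  haveI := isGloballyMinimal_67A1
  haveI : Fact (Nat.Prime 2) := ⟨Nat.prime_two⟩
  localTamagawaNumber_padic_eq_one_of_good_holds _ 2 hasGoodReductionAtPrime_two_67A1

/-- **`c₂(67a1)` is ODD** (`= 1`). [cite: KrizLi2019, Thm. 5.1 (hypothesis "c₂(E) odd") and §6 Table 2 (row 67a1)] -/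
theorem odd_localTamagawaNumber_two_67A1 :
    haveI : Fact (Nat.Prime 2) := ⟨Nat.prime_two⟩
    Odd (((⟨0, 1, 1, -12, -21⟩ : WeierstrassCurve ℚ).baseChange ℚ_[2]).localTamagawaNumber ℤ_[2]) := by
  rw [localTamagawaNumber_two_67A1]; exact odd_one

/-- **`67a1` is non-CM**: multiplicative at `67` (`67 ∣ Δ`, `67 ∤ c₄ = 592`), so `ord_67 j < 0` (`j = −2¹²·37³/67`). [cite: SilvermanAEC2009, App. C §11] -/
theorem not_hasCM_67A1 :
    haveI := isElliptic_67A1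
    ¬ (⟨0, 1, 1, -12, -21⟩ : WeierstrassCurve ℚ).HasCM := by
  haveI := isElliptic_67A1; haveI := isGloballyMinimal_67A1
  haveI : Fact (Nat.Prime 67) := ⟨by norm_num⟩
  exact AdditivePotMult.not_hasCM_of_padicValRat_j_neg (p := 67) (EisensteinPrimes.padicValRat_j_neg_of_mult _ 67
    (hasMultiplicativeReductionAtPrime_of_intModel intModel_67A1 67 (by rw [SSUnitAnchor.ua67a1_Δ]; decide) (by rw [SSUnitAnchor.ua67a1_c₄]; decide)))

/-- **`N(67a1) ∣ |Δ_min| = 67`.** [cite: SilvermanAEC2009, VIII.11 and C.16] -/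
theorem conductorNorm_dvd_67A1 :
    haveI := isElliptic_67A1
    (⟨0, 1, 1, -12, -21⟩ : WeierstrassCurve ℚ).conductorNorm ℤ ∣ 67 := by
  haveI := isElliptic_67A1; haveI := isGloballyMinimal_67A1
  have hdvd := WeierstrassCurve.conductorNorm_dvd_minimalDiscriminantNorm (⟨0, 1, 1, -12, -21⟩ : WeierstrassCurve ℚ)
    (WeierstrassCurve.finite_setOf_ordMinimalDiscriminant_ne_zero_holds _)
  rw [WeierstrassCurve.minimalDiscriminantNorm_int_eq_natAbs_minimalDiscriminantInt_holds,
    minimalDiscriminantInt_eq intModel_67A1, SSUnitAnchor.ua67a1_Δ] at hdvd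
  exact hdvd

/-- **`ord_67 N(67a1) = 1`** (multiplicative at `67`). [cite: Silverman1994, IV.11.1] -/
theorem factorization_conductorNorm_67A1 :
    haveI := isElliptic_67A1
    ((⟨0, 1, 1, -12, -21⟩ : WeierstrassCurve ℚ).conductorNorm ℤ).factorization 67 = 1 := by
  haveI := isElliptic_67A1; haveI := isGloballyMinimal_67A1
  haveI hE : ((⟨0, 1, 1, -12, -21⟩ : WeierstrassCurve ℤ).baseChange ℚ).IsElliptic := by rw [baseChange_int_67A1]; infer_instance
  have hN : Nat.Prime 67 := by norm_num
  set v : HeightOneSpectrum ℤ := (primesEquiv (R := ℤ)).symm ⟨67, hN⟩ with hv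
  have hgen : natGenerator v = 67 := congrArg Subtype.val ((primesEquiv (R := ℤ)).apply_symm_apply ⟨67, hN⟩)
  have hmin : ((⟨0, 1, 1, -12, -21⟩ : WeierstrassCurve ℤ).baseChange ℚ).IsMinimalAt v := by
    rw [baseChange_int_67A1]; exact IsGloballyMinimal.isMinimalAt_int _ v
  have h1 : ((⟨0, 1, 1, -12, -21⟩ : WeierstrassCurve ℤ).baseChange ℚ).conductorExponent v = 1 :=
    conductorExponent_eq_one_of_dvd_Δ_of_not_dvd_c₄ hmin (by rw [hgen, SSUnitAnchor.ua67a1_Δ]; decide) (by rw [hgen, SSUnitAnchor.ua67a1_c₄]; decide)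
  rw [baseChange_int_67A1] at h1
  rw [show (67 : ℕ) = ((⟨67, hN⟩ : Nat.Primes) : ℕ) from rfl, factorization_conductorNorm_primesEquiv_symm]
  exact h1

/-- **`N(67a1) = 67` IN THE KERNEL** (`N ∣ 67^1`, `N` has no prime factor other than `67`, `ord_67 N = 1`). [cite: CremonaAlgorithms1997, Table 1 (67A1)] -/
theorem conductorNorm_67A1 :
    haveI := isElliptic_67A1
    (⟨0, 1, 1, -12, -21⟩ : WeierstrassCurve ℚ).conductorNorm ℤ = 67 := by
  haveI := isElliptic_67A1
  set M := (⟨0, 1, 1, -12, -21⟩ : WeierstrassCurve ℚ).conductorNorm ℤ with hM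
  have hM0 : M ≠ 0 := (conductorNorm_pos_holds _).ne'
  have hp : Nat.Prime 67 := by norm_num
  have h1 := factorization_conductorNorm_67A1
  have hle := (Nat.factorization_le_iff_dvd hM0 (by norm_num : (67 : ℕ) ≠ 0)).mpr conductorNorm_dvd_67A1
  have eΔ : (67 : ℕ) = 67 ^ 1 := by norm_num
  refine Nat.eq_of_factorization_eq hM0 hp.ne_zero fun q => ?_
  rw [hp.factorization, Finsupp.single_apply]
  by_cases hq : 67 = q
  · subst hq; rw [if_pos rfl]; exact h1
  · rw [if_neg hq]
    have hq' := hle q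
    rw [eΔ, Nat.factorization_pow, Finsupp.smul_apply, hp.factorization, Finsupp.single_apply, if_neg hq, smul_zero] at hq'
    exact Nat.le_zero.mp hq'

/-- `N(67a1) ≠ 0` as an instance witness. [cite: CremonaAlgorithms1997, Table 1 (67A1)] -/
theorem neZero_conductorNorm_67A1 :
    haveI := isElliptic_67A1
    NeZero ((⟨0, 1, 1, -12, -21⟩ : WeierstrassCurve ℚ).conductorNorm ℤ) :=
  ⟨by rw [conductorNorm_67A1]; norm_num⟩

/-- **`N(67a1) < 5000`** (Creutz–Miller's range). [cite: CreutzMiller2012, Thm. 1.1] -/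
theorem conductorNorm_lt_5000_67A1 :
    haveI := isElliptic_67A1
    (⟨0, 1, 1, -12, -21⟩ : WeierstrassCurve ℚ).conductorNorm ℤ < 5000 := by
  rw [conductorNorm_67A1]; norm_num

end Base67A1

/-! ## §2 The partner `T′ = 67a1^{(−7)} = [0,-7,1,-588,7117]`: global minimal, `Δ = -7882483` (`7⁶·67^1` up to sign), `N(T′) = 7²·67 = 3283 < 5000` -/
section Partner67A1

/-- **The tree's quadratic twist `67a1^{(−7)}` IS `[0, -7, 0, -588, 28469 / 4]`** (`(b₂, b₄, b₆) = (4, -24, -83)`). [cite: SilvermanAEC2009, X.5 Cor. 5.4] -/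
theorem quadraticTwist_neg7_67A1 :
    (⟨0, 1, 1, -12, -21⟩ : WeierstrassCurve ℚ).quadraticTwist (-7) = (⟨0, -7, 0, -588, 28469 / 4⟩ : WeierstrassCurve ℚ) := by
  ext <;> norm_num [WeierstrassCurve.quadraticTwist, WeierstrassCurve.b₂, WeierstrassCurve.b₄, WeierstrassCurve.b₆]

/-- **`(1, 0, 0, ½) • 67a1^{(−7)} = [0,-7,1,-588,7117]`** — an integral minimal model of the companion (complete the square back: `y ↦ y + ½`).
[cite: SilvermanAEC2009, III.1 Table 3.1 and X.5 Cor. 5.4] -/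
theorem smul_quadraticTwist_neg7_67A1 :
    (⟨1, 0, 0, (1 : ℚ) / 2⟩ : VariableChange ℚ) • (⟨0, 1, 1, -12, -21⟩ : WeierstrassCurve ℚ).quadraticTwist (-7) = (⟨0, -7, 1, -588, 7117⟩ : WeierstrassCurve ℚ) := by
  rw [quadraticTwist_neg7_67A1]
  ext <;> norm_num [variableChange_a₁, variableChange_a₂, variableChange_a₃, variableChange_a₄, variableChange_a₆]

/-- `T′ = [0,-7,1,-588,7117]` is an elliptic curve (`Δ = -7882483 ≠ 0`). [cite: SilvermanAEC2009, III.1] -/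
theorem isElliptic_T67A1 : (⟨0, -7, 1, -588, 7117⟩ : WeierstrassCurve ℚ).IsElliptic := ⟨by
  rw [isUnit_iff_ne_zero]; norm_num [WeierstrassCurve.Δ, WeierstrassCurve.b₂, WeierstrassCurve.b₄, WeierstrassCurve.b₆, WeierstrassCurve.b₈]⟩

/-- `T′` is GLOBALLY MINIMAL (`|Δ| = 7⁶·67^1`: `v_p Δ < 12` everywhere). [cite: SilvermanAEC2009, VII.1 Remark 1.1] [cite: Kraus1989, Prop. 1 and Prop. 2] -/
theorem isGloballyMinimal_T67A1 : (⟨0, -7, 1, -588, 7117⟩ : WeierstrassCurve ℚ).IsGloballyMinimal :=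
  isGloballyMinimal_of_krausCriterion_support (0) (-7) (1) (-588) (7117) [(7, 0, 6), (67, 0, 1)]
    (by intro t ht; simp only [List.mem_cons, List.not_mem_nil, or_false] at ht
        rcases ht with rfl | rfl <;> norm_num)
    (by decide +kernel) (by decide +kernel)

/-- `Δ(T′) = -7882483`. [cite: CremonaAlgorithms1997, Table 1 (conductor 3283)] -/
theorem MT67A1_Δ : (⟨0, -7, 1, -588, 7117⟩ : WeierstrassCurve ℤ).Δ = -7882483 := by decide +kernel
/-- `c₄(T′) = 29008`. [cite: CremonaAlgorithms1997, Table 1 (conductor 3283)] -/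
theorem MT67A1_c₄ : (⟨0, -7, 1, -588, 7117⟩ : WeierstrassCurve ℤ).c₄ = 29008 := by decide +kernel

/-- The integer model base-changed to `ℚ` is the rational model. [folklore] -/
theorem baseChange_int_T67A1 :
    (⟨0, -7, 1, -588, 7117⟩ : WeierstrassCurve ℤ).baseChange ℚ = (⟨0, -7, 1, -588, 7117⟩ : WeierstrassCurve ℚ) := by
  ext <;> simp [WeierstrassCurve.baseChange, WeierstrassCurve.map]

/-- The integer model of `T′`. [cite: SilvermanAEC2009, VIII.8] -/
theorem intModel_T67A1 :
    haveI := isElliptic_T67A1; haveI := isGloballyMinimal_T67A1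
    integralModelInt (⟨0, -7, 1, -588, 7117⟩ : WeierstrassCurve ℚ) = (⟨0, -7, 1, -588, 7117⟩ : WeierstrassCurve ℤ) :=
  haveI := isElliptic_T67A1; haveI := isGloballyMinimal_T67A1
  integralModelInt_eq_of_map_eq _ (by ext <;> simp [WeierstrassCurve.map])

/-- **`N(T′) ∣ |Δ_min| = 7882483`.** [cite: SilvermanAEC2009, VIII.11 and C.16] -/
theorem conductorNorm_dvd_T67A1 :
    haveI := isElliptic_T67A1
    (⟨0, -7, 1, -588, 7117⟩ : WeierstrassCurve ℚ).conductorNorm ℤ ∣ 7882483 := by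
  haveI := isElliptic_T67A1; haveI := isGloballyMinimal_T67A1
  have hdvd := WeierstrassCurve.conductorNorm_dvd_minimalDiscriminantNorm (⟨0, -7, 1, -588, 7117⟩ : WeierstrassCurve ℚ)
    (WeierstrassCurve.finite_setOf_ordMinimalDiscriminant_ne_zero_holds _)
  rw [WeierstrassCurve.minimalDiscriminantNorm_int_eq_natAbs_minimalDiscriminantInt_holds,
    minimalDiscriminantInt_eq intModel_T67A1, MT67A1_Δ] at hdvd
  exact hdvd

/-- **Tate certificate for `T′` at `7`, kernel check** (Steps 1–6): translate by `(r,s,t) = (0,0,24)` to `[0,−7,49,−588,6517]` (`7 ∣ a₂`, `7² ∣ a₃, a₄`,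
`7³ ∣ a₆`); Step 6 exit: the cubic `T³ − T² − 12T + 19` has distinct roots mod `7` (discriminant `1489 ≢ 0`) — type `I₀*`, `v₇(Δ) = 6`.
[cite: Silverman1994, IV.9.4 Steps 1–6] -/
theorem tateDeepCheck_seven_T67A1 : DeepCert.check ⟨7, 0, 0, 24, 6, 6, 0⟩ ⟨0, -7, 1, -588, 7117⟩ = true := by
  decide +kernel

/-- **`f₇(T′) = 2`** (Ogg: `6 + 1 − 5` components of `I₀*`). [cite: Silverman1994, IV.11.1] -/
theorem conductorExponent_seven_T67A1 (v : HeightOneSpectrum ℤ) (hv : natGenerator v = 7) :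
    (⟨0, -7, 1, -588, 7117⟩ : WeierstrassCurve ℚ).conductorExponent v = 2 := by
  have h := DeepCert.conductorExponent_int_eq (W₀ := ⟨0, -7, 1, -588, 7117⟩) (c := ⟨7, 0, 0, 24, 6, 6, 0⟩) v hv
    (by rw [baseChange_int_T67A1]; exact isGloballyMinimal_T67A1) tateDeepCheck_seven_T67A1
  rw [baseChange_int_T67A1] at h
  exact h

/-- **`ord₇ N(T′) = 2`, `ord_67 N(T′) = 1`** (the latter: multiplicative at `67`, `67 ∣ Δ`, `67 ∤ c₄ = 29008`). [cite: Silverman1994, IV.11.1] -/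
theorem factorization_conductorNorm_T67A1 :
    haveI := isElliptic_T67A1
    (((⟨0, -7, 1, -588, 7117⟩ : WeierstrassCurve ℚ).conductorNorm ℤ).factorization 7 = 2) ∧
      (((⟨0, -7, 1, -588, 7117⟩ : WeierstrassCurve ℚ).conductorNorm ℤ).factorization 67 = 1) := by
  haveI := isElliptic_T67A1; haveI := isGloballyMinimal_T67A1
  haveI hE : ((⟨0, -7, 1, -588, 7117⟩ : WeierstrassCurve ℤ).baseChange ℚ).IsElliptic := by rw [baseChange_int_T67A1]; infer_instance
  have h7 : Nat.Prime 7 := by norm_num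
  have hN : Nat.Prime 67 := by norm_num
  refine ⟨?_, ?_⟩
  · rw [show (7 : ℕ) = ((⟨7, h7⟩ : Nat.Primes) : ℕ) from rfl, factorization_conductorNorm_primesEquiv_symm]
    exact conductorExponent_seven_T67A1 _ (congrArg Subtype.val ((primesEquiv (R := ℤ)).apply_symm_apply ⟨7, h7⟩))
  · set v : HeightOneSpectrum ℤ := (primesEquiv (R := ℤ)).symm ⟨67, hN⟩ with hv
    have hgen : natGenerator v = 67 := congrArg Subtype.val ((primesEquiv (R := ℤ)).apply_symm_apply ⟨67, hN⟩)
    have hmin : ((⟨0, -7, 1, -588, 7117⟩ : WeierstrassCurve ℤ).baseChange ℚ).IsMinimalAt v := by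
      rw [baseChange_int_T67A1]; exact IsGloballyMinimal.isMinimalAt_int _ v
    have h1 : ((⟨0, -7, 1, -588, 7117⟩ : WeierstrassCurve ℤ).baseChange ℚ).conductorExponent v = 1 :=
      conductorExponent_eq_one_of_dvd_Δ_of_not_dvd_c₄ hmin (by rw [hgen, MT67A1_Δ]; decide) (by rw [hgen, MT67A1_c₄]; decide)
    rw [baseChange_int_T67A1] at h1
    rw [show (67 : ℕ) = ((⟨67, hN⟩ : Nat.Primes) : ℕ) from rfl, factorization_conductorNorm_primesEquiv_symm]
    exact h1

/-- The prime factorisation of `7ᵃ·67ᵇ`, read coefficientwise. [folklore] -/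
theorem factorization_seven_pow_mul_pow_67A1 (a b q : ℕ) :
    (7 ^ a * 67 ^ b).factorization q = if q = 7 then a else if q = 67 then b else 0 := by
  have h7 : Nat.Prime 7 := by norm_num
  have hN : Nat.Prime 67 := by norm_num
  rw [Nat.factorization_mul (pow_ne_zero _ h7.ne_zero) (pow_ne_zero _ hN.ne_zero), Finsupp.add_apply,
    Nat.factorization_pow, Nat.factorization_pow, Finsupp.smul_apply, Finsupp.smul_apply, h7.factorization, hN.factorization,
    Finsupp.single_apply, Finsupp.single_apply]
  by_cases hq7 : q = 7
  · subst hq7; simp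
  by_cases hqN : q = 67
  · subst hqN; simp
  · simp [Ne.symm hq7, Ne.symm hqN, hq7, hqN]

/-- **`N(T′) = 3283 = 7²·67` IN THE KERNEL** (`N ∣ 7⁶·67^1`, `ord₇ N = 2`, `ord_67 N = 1`). [cite: CremonaAlgorithms1997, Table 1 (conductor 3283)] -/
theorem conductorNorm_T67A1 :
    haveI := isElliptic_T67A1
    (⟨0, -7, 1, -588, 7117⟩ : WeierstrassCurve ℚ).conductorNorm ℤ = 3283 := by
  haveI := isElliptic_T67A1
  set M := (⟨0, -7, 1, -588, 7117⟩ : WeierstrassCurve ℚ).conductorNorm ℤ with hM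
  have hM0 : M ≠ 0 := (conductorNorm_pos_holds _).ne'
  obtain ⟨h7, hN⟩ := factorization_conductorNorm_T67A1
  have hle := (Nat.factorization_le_iff_dvd hM0 (by norm_num : (7882483 : ℕ) ≠ 0)).mpr conductorNorm_dvd_T67A1
  have eN : (3283 : ℕ) = 7 ^ 2 * 67 ^ 1 := by norm_num
  have eΔ : (7882483 : ℕ) = 7 ^ 6 * 67 ^ 1 := by norm_num
  refine Nat.eq_of_factorization_eq hM0 (by norm_num) fun q => ?_
  rw [eN, factorization_seven_pow_mul_pow_67A1]
  by_cases hq7 : q = 7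
  · subst hq7; rw [h7]; simp
  by_cases hqN : q = 67
  · subst hqN; rw [hN]; simp
  have hq' := hle q
  rw [eΔ, factorization_seven_pow_mul_pow_67A1, if_neg hq7, if_neg hqN] at hq'
  rw [if_neg hq7, if_neg hqN]
  exact Nat.le_zero.mp hq'

/-- **`N(T′) < 5000`** (Creutz–Miller's range). [cite: CreutzMiller2012, Thm. 1.1] -/
theorem conductorNorm_lt_5000_T67A1 :
    haveI := isElliptic_T67A1
    (⟨0, -7, 1, -588, 7117⟩ : WeierstrassCurve ℚ).conductorNorm ℤ < 5000 := by
  rw [conductorNorm_T67A1]; norm_num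

end Partner67A1

/-! ## §3 The packet witness `ℓ = 29`: `#Ẽ(𝔽_29) = 35` (`a_29 = -5` odd) -/
section Witness67A1

/-- **`#Ẽ(𝔽_29) = 35` for `67a1`** (certified count; `29 ∤ Δ = -67`), so `a_29 = 30 − 35 = -5`. [cite: SilvermanAEC2009, V.2] -/
theorem reductionPointCount_29_67A1 :
    haveI := isGloballyMinimal_67A1
    (⟨0, 1, 1, -12, -21⟩ : WeierstrassCurve ℚ).reductionPointCount 29 = 35 := by
  haveI : Fact (Nat.Prime 29) := ⟨by norm_num⟩
  haveI := isElliptic_67A1; haveI := isGloballyMinimal_67A1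
  exact Supersingular.reductionPointCount_eq_of_intModel_countPoints intModel_67A1 29 (by norm_num) (by decide +kernel)
    (by decide +kernel)

/-- **`a_29(67a1)` is odd** (`= -5`: `Frob_29` has order `3` on `E[2]`). [cite: KrizLi2019, Def. 4.1 ("Frob_ℓ of order 3")] -/
theorem odd_frobeniusTrace_29_67A1 :
    haveI := isGloballyMinimal_67A1
    Odd ((⟨0, 1, 1, -12, -21⟩ : WeierstrassCurve ℚ).frobeniusTrace 29) := by
  haveI := isGloballyMinimal_67A1
  rw [Uniform.U2.odd_frobeniusTrace_iff_odd_reductionPointCount _ (by norm_num : Nat.Prime 29) (by norm_num),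
    reductionPointCount_29_67A1]
  decide

end Witness67A1

end Summit.BirchSwinnertonDyer.BirchSwinnertonDyer.Theorems.GenusExact.TwinSwap.KrizLiAnchor67a1

end
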